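import Summits.NavierStokesRegularity.NavierStokesRegularity.Theorems.GaldiLiouvilleGateParabolicGaldiLiouvilleStubLpsOfSobolev
import HarnessLib

/-!
# Crux `ParabolicGaldiLiouville` (stmt-NavierStokesRegularity-0893), line `birth`, reshaping 2:
# STUB `stub_lpsSixFourOfSobolev` — the bookkeeping of the SHARP dissipation gate `(s, l) = (6, 4)`

Lands `--supports stmt-NavierStokesRegularity-0893` the registered stub `stub_lpsSixFourOfSobolev`
of the lead's reshaped skeleton `Cruxes/ParabolicGaldiLiouville/Lines/birth.lean` (lead c1,
cycle 2). Among the Ladyzhenskaya–Prodi–Serrin classes `L^l_t L^s_x`, `3/s + 2/l = 1`, that the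
slices of the X2 class (`L^∞ ∩ L⁶ ∩ Ḣ¹`) can reach, the weakest time requirement is at
`(s, l) = (6, 4)`: `‖v(t)‖_{L⁶}⁴ ≤ K⁴ E(t)²`, `E(t) = ∫ |∇v(t)|_F²`, so SQUARE-INTEGRABILITY of the
enstrophy history `∫_{t<0} E(t)² dt < ∞` (the new open stub `stub_sqIntegrableEnstrophy`, weaker
than finite dissipation since `E ≤ C`) already feeds Seregin's Liouville theorem (Lecture Notes
2014, Thm 4.12, proved in the tree). This file is the measure-theoretic bookkeeping of that step,
GIVEN the slice-wise Sobolev inequality (the landed stub 2a) as an explicit hypothesis; the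
boundedness of `v` is not used.
-/

noncomputable section

set_option linter.dupNamespace false

open Set Function MeasureTheory
open scoped NNReal ENNReal
open Literature.Analysis Literature.Analysis.FluidPDE

namespace Summit.NavierStokesRegularity.NavierStokesRegularity.Theorems

namespace ParabolicGaldiLiouville.Birth

open LpsOfSobolev in
/-- **STUB 2b′ — `stub_lpsSixFourOfSobolev` (sharp gate, lead c1 reshaping 2).** GIVEN the
slice-wise Sobolev inequality `‖u‖_{L⁶} ≤ K (∫ |∇u|_F²)^{1/2}` for `C¹` fields `u ∈ L⁶(ℝ³; ℝ³)`
(explicit hypothesis = the landed stub 2a), a field `v` smooth on `(−∞,0) × ℝ³` with `L⁶` slices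
and square-integrable enstrophy history `∫_{t<0} (∫ |∇v(t)|_F²)² dt < ∞` has a finite
Ladyzhenskaya–Prodi–Serrin quantity at `(s, l) = (6, 4)`: `∫_{t<0} ‖v(t)‖_{L⁶}⁴ dt < ∞`. Proof:
slices are `C¹` (`LpsOfSobolev.contDiff_slice`); `‖v(t)‖₆⁴ ≤ K⁴ (∫ |∇v(t)|_F²)²` for each `t < 0`
(fourth power of the hypothesis); monotonicity of the time integral and `lintegral_const_mul'`.
[folklore] -/
theorem stub_lpsSixFourOfSobolev :
    (∃ K : NNReal, ∀ u : EuclideanSpace ℝ (Fin 3) → EuclideanSpace ℝ (Fin 3),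
      ContDiff ℝ 1 u → MeasureTheory.MemLp u 6 MeasureTheory.volume →
      MeasureTheory.eLpNorm u 6 MeasureTheory.volume ≤
        (K : ENNReal) * (∫⁻ y, ENNReal.ofReal
          (Literature.Analysis.FluidPDE.frobeniusNormSq (fderiv ℝ u y))) ^ (1 / 2 : ℝ)) →
    ∀ v : ℝ → EuclideanSpace ℝ (Fin 3) → EuclideanSpace ℝ (Fin 3),
      ContDiffOn ℝ (⊤ : ℕ∞) (Function.uncurry v) (Set.Iio 0 ×ˢ Set.univ) →
      (∀ s < 0, MeasureTheory.MemLp (v s) 6 MeasureTheory.volume) →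
      (∫⁻ s in Set.Iio 0, (∫⁻ y, ENNReal.ofReal
          (Literature.Analysis.FluidPDE.frobeniusNormSq (fderiv ℝ (v s) y))) ^ 2) < ⊤ →
      (∫⁻ t in Set.Iio 0,
          (MeasureTheory.eLpNorm (v t) (ENNReal.ofReal 6) MeasureTheory.volume) ^ (4 : ℝ)) < ⊤ := by
  intro hSob v hsm hL6 hsq
  obtain ⟨K, hK⟩ := hSob
  -- the slice-wise bound `‖v(t)‖₆⁴ ≤ K⁴ (∫ |∇v(t)|_F²)²` for every `t < 0`
  have hslice : ∀ t ∈ Iio (0 : ℝ),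
      eLpNorm (v t) (ENNReal.ofReal 6) volume ^ (4 : ℝ) ≤
        (K : ℝ≥0∞) ^ (4 : ℕ) * (∫⁻ y, ENNReal.ofReal (frobeniusNormSq (fderiv ℝ (v t) y))) ^ 2 := by
    intro t ht
    rw [ENNReal.ofReal_ofNat, ENNReal.rpow_ofNat]
    calc eLpNorm (v t) 6 volume ^ (4 : ℕ)
        ≤ ((K : ℝ≥0∞) * (∫⁻ y, ENNReal.ofReal
            (frobeniusNormSq (fderiv ℝ (v t) y))) ^ (1 / 2 : ℝ)) ^ (4 : ℕ) := by
          gcongr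
          exact hK (v t) (contDiff_slice hsm ht) (hL6 t ht)
      _ = (K : ℝ≥0∞) ^ (4 : ℕ) *
            (∫⁻ y, ENNReal.ofReal (frobeniusNormSq (fderiv ℝ (v t) y))) ^ 2 := by
          rw [mul_pow, ← ENNReal.rpow_mul_natCast]
          norm_num
  have hc : (K : ℝ≥0∞) ^ (4 : ℕ) ≠ ⊤ := ENNReal.pow_ne_top ENNReal.coe_ne_top
  calc ∫⁻ t in Iio 0, eLpNorm (v t) (ENNReal.ofReal 6) volume ^ (4 : ℝ)
      ≤ ∫⁻ t in Iio 0, (K : ℝ≥0∞) ^ (4 : ℕ) *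
          (∫⁻ y, ENNReal.ofReal (frobeniusNormSq (fderiv ℝ (v t) y))) ^ 2 :=
        setLIntegral_mono' measurableSet_Iio hslice
    _ = (K : ℝ≥0∞) ^ (4 : ℕ) *
          ∫⁻ t in Iio 0, (∫⁻ y, ENNReal.ofReal (frobeniusNormSq (fderiv ℝ (v t) y))) ^ 2 :=
        lintegral_const_mul' _ _ hc
    _ < ⊤ := ENNReal.mul_lt_top hc.lt_top hsq

end ParabolicGaldiLiouville.Birth

end Summit.NavierStokesRegularity.NavierStokesRegularity.Theorems

end
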